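import Summits.ABC.IUTFork.Joshi.LogVolumesHulls

/-!
# [J-III] Prop. 9.10.8.1 (3) / Rmk. 9.10.8.2 «hulls and convex closures on an equal footing» — AS-TYPED PROBE

K. Joshi, *Construction of Arithmetic Teichmüller Spaces III* (arXiv:2401.13508 **v4**, unrefereed; bib
`Joshi2024ATS3`), §9.10.8, p.126 l.22–37, p.127 l.1–2. Cell abc-iut, block E (rung LADDER-ABC:A2.E), seat E-t23 (slot
T-23, OBJECTS O-045): the one §9.10 assertion typed as a HYPOTHESIS in `LogVolumesHulls` (p428811),
`LogVol.HullEqImageConvexClosure R O f TensorRegion` («H(P) is the image of the convex closure of P» for every «tensor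
product region» `P`), probed in the kernel over the abstract signature it was typed in. Two facts, both PROVED:
(A) `hullEqImageConvexClosure_of`: (3) HOLDS for any family of regions that are convex (in Schneider's sense, as
Joshi's (1) uses: «the hull is a ℤ_p-module … convex») and whose image under `f` is a Joshi hull-set `⊕_α λ_α𝒪_α` —
then both sides equal `f(P)`. (B) `not_hullEqImageConvexClosure_congruenceLattice`: (3) FAILS, as typed, for the
family `{P}` with `P` the index-2 «congruence lattice» `{(a, b) ∈ 𝒪 × 𝒪 : a ≡ b mod 2}` in two summands over the
abstract instance `R = 𝒪 = ℤ ⊂ k = ℚ` (standing for `ℤ_p ⊂ ℚ_p`; the shape of a ramified lattice tensor `𝒪_K ⊗_{ℤ_p}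
𝒪_K ↪ 𝒪_K × 𝒪_K`, [IUTchIII] Rmk. 3.9.2): `P` is a submodule, hence convex and equal to its convex closure, while
its hull is all of `𝒪 × 𝒪 ∋ (1, 0) ∉ P`. LOCATION (no verdict on print): the content of (3) is «the image of a
tensor product region is already of the form ⊕_α λ_α𝒪_α»; it fails for non-direct-product lattices and holds for
direct-product ones; and it is HARMLESS for the direction in which Lem. 9.10.7.1 / Thm. 9.11.1 use hulls (`hull(S) ⊇
S`, volumes bounded BELOW — `TensorVolumeDatum.lemma_9_10_7_1` never invokes (3)). Which class of regions print
intends by «tensor product region in the sense of [Mochizuki, 2021c, Remark 3.1.1]» is for E-ref. FRAMING: typed ≠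
proved; no side taken on [IUTchIII] Cor. 3.12 or on any author.
-/

namespace Summit.ABC.IUTFork.Joshi.LogVol

/-! ## (A) The sufficient condition under which (3) holds -/

section Holds

variable {R : Type*} [CommRing R] {X : Type*} [AddCommGroup X] [Module R X]
  {A : Type*} {k : A → Type*} [∀ a, Field (k a)] [∀ a, Algebra R (k a)] (O : ∀ a, Subring (k a))

/-- A convex set is its own convex closure. [folklore] -/
theorem convexClosure_eq_self_of_isConvexNA {C : Set X} (h : IsConvexNA R C) : convexClosure R C = C :=
  (Set.sInter_subset_of_mem (show C ∈ {D | IsConvexNA R D ∧ C ⊆ D} from ⟨h, le_rfl⟩)).antisymm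
    (Set.subset_sInter fun _ hD => hD.2)

/-- **(3) holds for convex regions whose images are Joshi hull-sets**: then `hull(f(P)) = f(P) = f(conv P)`. PROVED.
[claim: Joshi2024ATS3, status: disputed] -/
theorem hullEqImageConvexClosure_of (f : X →ₗ[R] (∀ a, k a)) {TensorRegion : Set (Set X)}
    (h : ∀ P ∈ TensorRegion, IsConvexNA R P ∧ IsJoshiHullSet O (f '' P)) :
    HullEqImageConvexClosure R O f TensorRegion := fun P hP => by
  rw [joshiHull_eq_self O (h P hP).2, convexClosure_eq_self_of_isConvexNA (h P hP).1]

end Holds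

/-! ## (B) The as-typed counter-instance: the congruence lattice in two summands over `ℤ ⊂ ℚ` -/

section Fails

/-- The integers `ℤ ⊂ ℚ` as a subring (standing for `ℤ_p ⊂ ℚ_p` in this abstract probe). [folklore] -/
def intSubring : Subring ℚ := (Int.castRingHom ℚ).range

/-- Membership in `intSubring`: the rational is an integer. [folklore] -/
theorem mem_intSubring {x : ℚ} : x ∈ intSubring ↔ ∃ n : ℤ, (n : ℚ) = x := by
  simp [intSubring, RingHom.mem_range]

/-- The two-summand integral structure `𝒪 × 𝒪 ⊂ ℚ × ℚ`. [folklore] -/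
def intPair : ∀ _ : Fin 2, Subring ℚ := fun _ => intSubring

/-- The index-2 **congruence lattice** `P = {(a, b) ∈ ℤ × ℤ : a ≡ b (mod 2)}` as a `ℤ`-submodule of `ℚ × ℚ` (the shape of
a ramified lattice tensor sitting inside the direct sum of the integer rings). [folklore] -/
def congruenceLattice : Submodule ℤ (Fin 2 → ℚ) where
  carrier := {v | ∃ a b : ℤ, v 0 = a ∧ v 1 = b ∧ (2 : ℤ) ∣ a - b}
  zero_mem' := ⟨0, 0, by simp, by simp, by simp⟩
  add_mem' := by
    rintro v w ⟨a, b, ha, hb, hab⟩ ⟨a', b', ha', hb', hab'⟩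
    refine ⟨a + a', b + b', by simp [ha, ha'], by simp [hb, hb'], ?_⟩
    have : a + a' - (b + b') = (a - b) + (a' - b') := by ring
    rw [this]; exact dvd_add hab hab'
  smul_mem' := by
    rintro n v ⟨a, b, ha, hb, hab⟩
    refine ⟨n * a, n * b, by simp [ha], by simp [hb], ?_⟩
    have : n * a - n * b = n * (a - b) := by ring
    rw [this]; exact dvd_mul_of_dvd_right hab n

/-- `P` is convex (it is a submodule: `P = 0 + P`). [folklore] -/
theorem isConvexNA_congruenceLattice : IsConvexNA ℤ (congruenceLattice : Set (Fin 2 → ℚ)) :=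
  Or.inr ⟨0, congruenceLattice, by simp⟩

/-- `(1, 1) ∈ P`. [folklore] -/
theorem one_one_mem_congruenceLattice : (fun _ => (1 : ℚ)) ∈ (congruenceLattice : Set (Fin 2 → ℚ)) :=
  ⟨1, 1, by simp, by simp, by simp⟩

/-- `(1, 0) ∉ P` (`1 ≢ 0 mod 2`). [folklore] -/
theorem single_not_mem_congruenceLattice :
    (fun i : Fin 2 => if i = 0 then (1 : ℚ) else 0) ∉ (congruenceLattice : Set (Fin 2 → ℚ)) := by
  rintro ⟨a, b, ha, hb, hab⟩
  simp only [Fin.isValue, ↓reduceIte, one_ne_zero] at ha hb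
  have ha1 : a = 1 := by exact_mod_cast ha.symm
  have hb0 : b = 0 := by exact_mod_cast hb.symm
  subst ha1 hb0
  omega

/-- Every Joshi hull-set `λ_1𝒪 × λ_2𝒪` containing `P` contains `(1, 0)` (it contains `(1, 1)`, so `1 ∈ λ_1𝒪`, and `0 ∈
λ_2𝒪`); hence `(1, 0)` lies in the hull of `P`. [folklore] -/
theorem single_mem_joshiHull_congruenceLattice :
    (fun i : Fin 2 => if i = 0 then (1 : ℚ) else 0) ∈ joshiHull intPair (congruenceLattice : Set (Fin 2 → ℚ)) := by
  refine Set.mem_sInter.2 fun H hH => ?_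
  obtain ⟨⟨lam, hlam, rfl⟩, hPH⟩ := hH
  have h11 := hPH one_one_mem_congruenceLattice
  simp only [Set.mem_univ_pi, Set.mem_image, SetLike.mem_coe] at h11 ⊢
  intro i
  by_cases hi : i = 0
  · subst hi
    obtain ⟨x, hx, hx1⟩ := h11 0
    exact ⟨x, hx, by simpa using hx1⟩
  · exact ⟨0, (intPair i).zero_mem, by simp [hi]⟩

/-- **Prop. 9.10.8.1 (3) FAILS as typed** for the family `{P}`, `P` the congruence lattice, over `R = 𝒪 = ℤ ⊂ ℚ` in two
summands with `f = id`: `hull(P) ∋ (1, 0) ∉ P = conv(P)`. PROVED. LOCATION only: print's «tensor product region» class is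
not fixed by the text, and the failure is harmless for the lower-bound direction §9.10–§9.11 use. [claim: Joshi2024ATS3, status: disputed] -/
theorem not_hullEqImageConvexClosure_congruenceLattice :
    ¬ HullEqImageConvexClosure ℤ intPair (LinearMap.id : (Fin 2 → ℚ) →ₗ[ℤ] (Fin 2 → ℚ))
      {(congruenceLattice : Set (Fin 2 → ℚ))} := by
  intro h
  have hP := h _ (Set.mem_singleton _)
  rw [LinearMap.id_coe, Set.image_id, Set.image_id, convexClosure_eq_self_of_isConvexNA isConvexNA_congruenceLattice]
    at hP
  exact single_not_mem_congruenceLattice (hP ▸ single_mem_joshiHull_congruenceLattice)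

/-- … while (3) HOLDS for the family of Joshi hull-sets themselves (direct-product integral boxes), by (A). [folklore] -/
theorem hullEqImageConvexClosure_hullSets :
    HullEqImageConvexClosure ℤ intPair (LinearMap.id : (Fin 2 → ℚ) →ₗ[ℤ] (Fin 2 → ℚ))
      {P | IsJoshiHullSet intPair P} :=
  hullEqImageConvexClosure_of intPair LinearMap.id fun P hP =>
    ⟨(IsJoshiHullSet.isConvexNA ℤ intPair (fun a r => mem_intSubring.2 ⟨r, by simp⟩) hP),
      by rw [LinearMap.id_coe, Set.image_id]; exact hP⟩

end Fails

end Summit.ABC.IUTFork.Joshi.LogVol
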